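import Summits.QuantumAdvantage.AdviceFreeQNC0.TwoBlindSpotsPlusFibre
import Summits.QuantumAdvantage.AdviceFreeQNC0.WalkGapNaming
import Summits.QuantumAdvantage.AdviceFreeQNC0.WalkHardFAnchoredDirect
import HarnessLib

/-!
# Cell qa-qnc0 (odd primes), rung R7 `WalkHardFPairLocal` — the PAIR FIBRE and the three-speed parity argument

Planner qa-qnc0-p2 g15, ROUND-15 §3 (the first DENSE class: strategies in which one adjacent bit pair
`(a, a+1)` is read only by nearby cuts).  This file is the engine of `WalkHardFPairLocal.lean`; it replaces the
memo's `V₄` end-game register calculus and its machine-checked finite lemma by a two-line parity identity.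

SET-UP.  Inputs of length `a + 2 + q`; the REST VARIABLE `v ∈ {0,1}^{a+q}` (left block `vL v`, right block
`vR v`) is embedded with the right block COMPLEMENTED and the pair filled at speed `t ∈ {0,1,2}`:
`emb t v := vL v ++ zvec t ++ ¬(vR v)`, `|zvec t| = t`.  (The complement makes every near-cut phase congruent
to `2|v| + (local data)`: `|emb t v| ≡ |vL| − |vR| + t + q` and `W_g ≡ |vL| + …`.)

THE ARGUMENT (`exists_lose`).  Cut `g` COUNTS at speed `t` iff `y_g(emb t v) = 1 ∧ c + g + |u| + W_g(u) ≢ 0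
(mod 3)`, `u = emb t v`; the player wins at speed `t` iff the number of counting cuts is odd.  Summing over the
THREE speeds and exchanging the sums, `Σ_t #S_t(v) = Σ_g #T_g(v)` with `T_g(v) = {t : g counts at speed t}`.
A FAR cut (`g + w < a` or `g > a + 2 + w`, hence pair-independent) has the same output at all three speeds and
phase `X + t` (left) resp. `X + 2t` (right), so `#T_g ∈ {0, 2}`: far cuts DROP OUT mod 2.  For a NEAR cut the
phase is `≡ 2|v| + Ω_g(t)` with `Ω_g(t) mod 3` determined by the `≤ 2w` local rest-bits (`Om_mod_congr`), so
`Σ_t Win_t(v) ≡ M(v, 2|v| mod 3)` where `M(v, ·)` is a function of the near outputs and the local bits only,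
and `Σ_{q ∈ ℤ/3} M(v, q) ≡ 0` (a fired `(g, t)` counts for exactly two phases).  Hence the NAMED PHASE
`E(v) :=` (a `q` with `M(v,q)` even) satisfies: `2|v| ≡ E(v) (mod 3) ⇒` not all three speeds win.  Its level
sets have `𝔽_p`-degree `≤ (8w+9)·D` (`PairSpeedNaming.lean`, via the pattern-degree lemma), which is what
`ElimHardF` consumes in `WalkHardFPairLocal.lean`.  (Why three speeds: with two, a far cut counts at 1 or 2
of them and does not drop out — the memo's control experiment; why `|bad σ|` is odd in the memo's table:
`Σ_q M(v,q)` is even.)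

WHAT THIS IS NOT: nothing on far-read strategies (the dense core, `DenseResidualSqrtOdd` minus R7, stays OPEN);
separation NOT moved.
-/

noncomputable section

namespace Summit.QuantumAdvantage.AdviceFreeQNC0

open Classical
open Finset
open Literature.Computability.MetaComplexity Literature.Computability.MetaComplexity.Smolensky

namespace PairSpeed

variable {a q : ℕ}

/-! ### The embedding of the rest variable -/

/-- The speed-`t` filling of the pair: bit `j` is `[j < t]`, so `|zvec t| = t`. -/
def zvec (t : Fin 3) : Fin 2 → Bool := fun j => decide (j.val < t.val)

/-- `|zvec t| = t`. -/
theorem wt_zvec (t : Fin 3) : wt (zvec t) = t.val := by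
  unfold wt zvec; fin_cases t <;> decide

/-- `W_1(zvec t) = [0 < t]`. -/
theorem wtPrefix_zvec_one (t : Fin 3) : wtPrefix (zvec t) 1 = if 0 < t.val then 1 else 0 := by
  unfold wtPrefix zvec; fin_cases t <;> decide

/-- Left block of the rest variable. -/
def vL (v : Fin (a + q) → Bool) : Fin a → Bool := fun j => v (Fin.castAdd q j)

/-- Right block of the rest variable. -/
def vR (v : Fin (a + q) → Bool) : Fin q → Bool := fun j => v (Fin.natAdd a j)

/-- The rest variable is its two blocks appended. -/
theorem append_vL_vR (v : Fin (a + q) → Bool) : Fin.append (vL v) (vR v) = v := by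
  funext i
  induction i using Fin.addCases with
  | left j => rw [Fin.append_left]; rfl
  | right j => rw [Fin.append_right]; rfl

/-- `|v| = |vL v| + |vR v|`. -/
theorem wt_rest (v : Fin (a + q) → Bool) : wt v = wt (vL v) + wt (vR v) := by
  conv_lhs => rw [← append_vL_vR v]
  exact wt_append _ _

/-- **The pair fibre embedding** `emb t v = vL v ++ zvec t ++ ¬ vR v`. -/
def emb (t : Fin 3) (v : Fin (a + q) → Bool) : Fin (a + 2 + q) → Bool :=
  glue3 (vL v) (zvec t) (fun j => ! vR v j)

/-- Left positions read the left block. -/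
theorem emb_apply_lt (t : Fin 3) (v : Fin (a + q) → Bool) (i : Fin (a + 2 + q)) (hi : i.val < a) :
    emb t v i = v ⟨i.val, by omega⟩ := by
  unfold emb; rw [glue3_apply_lt _ _ _ i hi]; rfl

/-- Right positions read the complemented right block. -/
theorem emb_apply_ge (t : Fin 3) (v : Fin (a + q) → Bool) (i : Fin (a + 2 + q)) (hi : a + 2 ≤ i.val) :
    emb t v i = ! v ⟨i.val - 2, by omega⟩ := by
  unfold emb; rw [glue3_apply_ge _ _ _ i hi]
  unfold vR
  congr 2
  ext
  simp only [Fin.natAdd_mk]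
  omega

/-- The three speeds agree off the pair. -/
theorem emb_eq_off_pair (t t' : Fin 3) (v : Fin (a + q) → Bool) (i : Fin (a + 2 + q))
    (h1 : i.val ≠ a) (h2 : i.val ≠ a + 1) : emb t v i = emb t' v i := by
  unfold emb; exact glue3_eq_outside _ _ _ _ i (by omega)

/-- The embedding determines the rest variable. -/
theorem emb_inj {t t' : Fin 3} {v v' : Fin (a + q) → Bool} (h : emb t v = emb t' v') : v = v' := by
  funext i
  by_cases hi : i.val < a
  · have h1 := congrFun h ⟨i.val, by omega⟩
    rw [emb_apply_lt _ _ _ hi, emb_apply_lt _ _ _ hi] at h1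
    exact h1
  · have h1 := congrFun h ⟨i.val + 2, by omega⟩
    rw [emb_apply_ge _ _ _ (by simp; omega), emb_apply_ge _ _ _ (by simp; omega)] at h1
    have e : (⟨(⟨i.val + 2, by omega⟩ : Fin (a + 2 + q)).val - 2, by simp⟩ : Fin (a + q)) = i :=
      Fin.ext (by simp)
    rw [e] at h1
    exact Bool.not_inj h1

/-! ### Weights through the embedding -/

/-- `W_g(u) ≤ g`. -/
theorem wtPrefix_le_self {m : ℕ} (u : Fin m → Bool) {g : ℕ} (hg : g ≤ m) : wtPrefix u g ≤ g := by
  have h := wtPrefix_not (fun i => !u i) hg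
  simp only [Bool.not_not] at h
  change wtPrefix u g = _ at h
  omega

/-- `|emb t v| + |vR v| = |vL v| + t + q`. -/
theorem wt_emb (t : Fin 3) (v : Fin (a + q) → Bool) : wt (emb t v) + wt (vR v) = wt (vL v) + t.val + q := by
  unfold emb
  rw [wt_glue3, wt_zvec, wt_not]
  have : wt (vR v) ≤ q := by
    have h := wtPrefix_le_self (vR v) le_rfl
    rwa [wtPrefix_of_length_le _ le_rfl] at h
  omega

/-- Before the pair the prefix weights are those of the left block. -/
theorem wtPrefix_emb_of_le (t : Fin 3) (v : Fin (a + q) → Bool) {g : ℕ} (hg : g ≤ a) :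
    wtPrefix (emb t v) g = wtPrefix (vL v) g :=
  wtPrefix_glue3_of_le _ _ _ hg

/-- Between the two pair bits. -/
theorem wtPrefix_emb_succ (t : Fin 3) (v : Fin (a + q) → Bool) :
    wtPrefix (emb t v) (a + 1) = wt (vL v) + (if 0 < t.val then 1 else 0) := by
  unfold emb; rw [wtPrefix_glue3_window _ _ _ (by norm_num : 1 ≤ 2), wtPrefix_zvec_one]

/-- After the pair: `W_g(emb t v) + W_{g-a-2}(vR v) = |vL v| + t + (g - a - 2)`. -/
theorem wtPrefix_emb_of_ge (t : Fin 3) (v : Fin (a + q) → Bool) {g : ℕ} (hg : a + 2 ≤ g)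
    (hgq : g ≤ a + 2 + q) :
    wtPrefix (emb t v) g + wtPrefix (vR v) (g - (a + 2)) = wt (vL v) + t.val + (g - (a + 2)) := by
  unfold emb
  rw [wtPrefix_glue3_of_ge _ _ _ hg, wt_zvec, wtPrefix_not _ (by omega : g - (a + 2) ≤ q)]
  have := wtPrefix_le_self (vR v) (by omega : g - (a + 2) ≤ q)
  omega

/-- Before the pair the walk exponent moves with speed `1`: `e_g(emb t v) = e_g(emb 0 v) + t`. -/
theorem walkExp_emb_of_le (t : Fin 3) (v : Fin (a + q) → Bool) {g : ℕ} (hg : g ≤ a) :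
    walkExp (emb t v) g = walkExp (emb 0 v) g + t.val := by
  unfold walkExp
  rw [wtPrefix_emb_of_le t v hg, wtPrefix_emb_of_le 0 v hg]
  have h1 := wt_emb t v
  have h0 := wt_emb 0 v
  simp only [Fin.val_zero, add_zero] at h0
  omega

/-- After the pair the walk exponent moves with speed `2`: `e_g(emb t v) = e_g(emb 0 v) + 2t`. -/
theorem walkExp_emb_of_ge (t : Fin 3) (v : Fin (a + q) → Bool) {g : ℕ} (hg : a + 2 ≤ g)
    (hgq : g ≤ a + 2 + q) : walkExp (emb t v) g = walkExp (emb 0 v) g + 2 * t.val := by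
  unfold walkExp
  have h1 := wt_emb t v
  have h0 := wt_emb 0 v
  have h3 := wtPrefix_emb_of_ge t v hg hgq
  have h4 := wtPrefix_emb_of_ge 0 v hg hgq
  simp only [Fin.val_zero, add_zero] at h0 h4
  omega

/-! ### Counting cuts over the three speeds -/

variable (c : ℕ) (y : Fin (a + 2 + q + 1) → (Fin (a + 2 + q) → Bool) → Bool)

/-- The speeds at which cut `g` COUNTS over the rest input `v` (cut `g` counts at speed `t` iff
`y_g(emb t v) = 1` and `c + g + e_g(emb t v) ≢ 0 (mod 3)` — the summand of `ringWinU`). -/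
def T (g : Fin (a + 2 + q + 1)) (v : Fin (a + q) → Bool) : Finset (Fin 3) :=
  univ.filter fun t => y g (emb t v) = true ∧ (c + g.val + walkExp (emb t v) g.val) % 3 ≠ 0

/-- The win bit at speed `t` is the parity of the number of counting cuts. -/
theorem ringWinU_emb_iff (t : Fin 3) (v : Fin (a + q) → Bool) :
    ringWinU c y (emb t v) = true ↔ (univ.filter fun g : Fin (a + 2 + q + 1) =>
      y g (emb t v) = true ∧ (c + g.val + walkExp (emb t v) g.val) % 3 ≠ 0).card % 2 = 1 := by
  unfold ringWinU
  rw [decide_eq_true_eq]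

/-- Exchange of summation: `Σ_t #S_t = Σ_g #T_g`. -/
theorem sum_card_speeds (v : Fin (a + q) → Bool) :
    ∑ t : Fin 3, (univ.filter fun g : Fin (a + 2 + q + 1) =>
      y g (emb t v) = true ∧ (c + g.val + walkExp (emb t v) g.val) % 3 ≠ 0).card =
      ∑ g, (T c y g v).card := by
  simp only [T, Finset.card_filter]
  exact Finset.sum_comm

/-- Exactly two of the three speed-`1` phases are non-zero. -/
theorem card_phase_one (X : ℕ) : (univ.filter fun t : Fin 3 => (X + t.val) % 3 ≠ 0).card = 2 := by
  have h3 : X % 3 < 3 := Nat.mod_lt _ (by norm_num)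
  have key : ∀ x < 3, (univ.filter fun t : Fin 3 => (x + t.val) % 3 ≠ 0).card = 2 := by decide
  calc (univ.filter fun t : Fin 3 => (X + t.val) % 3 ≠ 0).card
      = (univ.filter fun t : Fin 3 => (X % 3 + t.val) % 3 ≠ 0).card :=
        congrArg _ (Finset.filter_congr fun t _ => by constructor <;> intro h <;> omega)
    _ = 2 := key (X % 3) h3

/-- Exactly two of the three speed-`2` phases are non-zero. -/
theorem card_phase_two (X : ℕ) : (univ.filter fun t : Fin 3 => (X + 2 * t.val) % 3 ≠ 0).card = 2 := by
  have h3 : X % 3 < 3 := Nat.mod_lt _ (by norm_num)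
  have key : ∀ x < 3, (univ.filter fun t : Fin 3 => (x + 2 * t.val) % 3 ≠ 0).card = 2 := by decide
  calc (univ.filter fun t : Fin 3 => (X + 2 * t.val) % 3 ≠ 0).card
      = (univ.filter fun t : Fin 3 => (X % 3 + 2 * t.val) % 3 ≠ 0).card :=
        congrArg _ (Finset.filter_congr fun t _ => by constructor <;> intro h <;> omega)
    _ = 2 := key (X % 3) h3

/-- **Far cuts drop out**: a pair-independent cut outside the pair counts at `0` or `2` speeds. -/
theorem card_T_even {g : Fin (a + 2 + q + 1)} (hg : g.val < a ∨ a + 2 ≤ g.val)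
    (hind : ∀ u u' : Fin (a + 2 + q) → Bool, (∀ i : Fin (a + 2 + q), i.val ≠ a → i.val ≠ a + 1 → u i = u' i) →
      y g u = y g u')
    (v : Fin (a + q) → Bool) : (T c y g v).card % 2 = 0 := by
  have hy : ∀ t, y g (emb t v) = y g (emb 0 v) := fun t =>
    hind _ _ fun i h1 h2 => emb_eq_off_pair t 0 v i h1 h2
  by_cases h0 : y g (emb 0 v) = true
  · rcases hg with hg | hg
    · have hT : T c y g v = univ.filter fun t : Fin 3 =>
          (c + g.val + walkExp (emb 0 v) g.val + t.val) % 3 ≠ 0 := by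
        refine Finset.filter_congr fun t _ => ?_
        rw [hy t, walkExp_emb_of_le t v hg.le]
        constructor
        · rintro ⟨-, h⟩; intro h'; exact h (by omega)
        · intro h; exact ⟨h0, fun h' => h (by omega)⟩
      rw [hT, card_phase_one]
    · have hT : T c y g v = univ.filter fun t : Fin 3 =>
          (c + g.val + walkExp (emb 0 v) g.val + 2 * t.val) % 3 ≠ 0 := by
        refine Finset.filter_congr fun t _ => ?_
        rw [hy t, walkExp_emb_of_ge t v hg (by omega)]
        constructor
        · rintro ⟨-, h⟩; intro h'; exact h (by omega)
        · intro h; exact ⟨h0, fun h' => h (by omega)⟩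
      rw [hT, card_phase_two]
  · have hT : T c y g v = ∅ := by
      refine Finset.filter_eq_empty_iff.2 fun t _ => ?_
      rw [hy t]; exact fun h => h0 h.1
    rw [hT, card_empty]

/-! ### Near cuts: the phase is `2|v| + Ω` with `Ω mod 3` local -/

/-- The de-phased exponent `Ω_g(t, v) := c + g + e_g(emb t v) + |v|` (so the phase is `≡ 2|v| + Ω`). -/
def Om (g : Fin (a + 2 + q + 1)) (t : Fin 3) (v : Fin (a + q) → Bool) : ℕ :=
  c + g.val + walkExp (emb t v) g.val + wt v

/-- Counting in terms of the phase `2|v| mod 3` and `Ω`. -/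
theorem cnt_iff (g : Fin (a + 2 + q + 1)) (t : Fin 3) (v : Fin (a + q) → Bool) :
    (y g (emb t v) = true ∧ (c + g.val + walkExp (emb t v) g.val) % 3 ≠ 0) ↔
      (y g (emb t v) = true ∧ ((2 * wt v) % 3 + Om c g t v) % 3 ≠ 0) := by
  unfold Om
  constructor
  · rintro ⟨h1, h2⟩; exact ⟨h1, fun h => h2 (by omega)⟩
  · rintro ⟨h1, h2⟩; exact ⟨h1, fun h => h2 (by omega)⟩

/-- The NEAR cuts: within distance `w` of the pair. -/
def near (w : ℕ) : Finset (Fin (a + 2 + q + 1)) :=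
  univ.filter fun g => a ≤ g.val + w ∧ g.val ≤ a + 2 + w

/-- `M(v, qq)`: number of (near cut, speed) pairs that fire and count under phase `qq`. -/
def M (w : ℕ) (v : Fin (a + q) → Bool) (qq : ℕ) : ℕ :=
  ∑ g ∈ near w, (univ.filter fun t : Fin 3 => y g (emb t v) = true ∧ (qq + Om c g t v) % 3 ≠ 0).card

/-- The near part of `Σ_g #T_g` is `M(v, 2|v| mod 3)`. -/
theorem sum_near_T (w : ℕ) (v : Fin (a + q) → Bool) :
    ∑ g ∈ near w, (T c y g v).card = M c y w v ((2 * wt v) % 3) := by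
  unfold M
  refine Finset.sum_congr rfl fun g _ => congrArg _ (Finset.filter_congr fun t _ => cnt_iff c y g t v)

/-- **Each fired (cut, speed) counts for exactly two phases**: `M(v,0) + M(v,1) + M(v,2)` is even. -/
theorem M_sum_even (w : ℕ) (v : Fin (a + q) → Bool) :
    (M c y w v 0 + M c y w v 1 + M c y w v 2) % 2 = 0 := by
  unfold M
  rw [← Finset.sum_add_distrib, ← Finset.sum_add_distrib, Finset.sum_nat_mod,
    Finset.sum_eq_zero, Nat.zero_mod]
  intro g _
  simp only [Finset.card_filter]
  rw [← Finset.sum_add_distrib, ← Finset.sum_add_distrib, Finset.sum_nat_mod, Finset.sum_eq_zero,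
    Nat.zero_mod]
  intro t _
  have h3 : Om c g t v % 3 < 3 := Nat.mod_lt _ (by norm_num)
  by_cases hy : y g (emb t v) = true
  · simp only [hy, true_and]
    split_ifs <;> omega
  · simp [hy]

/-- **The named phase** `E(v)`: a phase `q ∈ {0,1,2}` with `M(v, q)` even. -/
def E (w : ℕ) (v : Fin (a + q) → Bool) : ℕ :=
  if M c y w v 0 % 2 = 0 then 0 else if M c y w v 1 % 2 = 0 then 1 else 2

/-- `E(v) < 3`. -/
theorem E_lt (w : ℕ) (v : Fin (a + q) → Bool) : E c y w v < 3 := by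
  unfold E; split_ifs <;> norm_num

/-- `M(v, E v)` is even. -/
theorem M_E_even (w : ℕ) (v : Fin (a + q) → Bool) : M c y w v (E c y w v) % 2 = 0 := by
  have h := M_sum_even c y w v
  unfold E
  split_ifs with h0 h1
  · exact h0
  · exact h1
  · omega

/-- **Three-speed parity lemma**: if the far cuts do not read the pair and `2|v| ≡ E(v) (mod 3)`, then the
player LOSES at one of the three speeds over `v`. -/
theorem exists_lose (w : ℕ)
    (hfar : ∀ g : Fin (a + 2 + q + 1), (g.val + w < a ∨ a + 2 + w < g.val) →
      ∀ u u' : Fin (a + 2 + q) → Bool, (∀ i : Fin (a + 2 + q), i.val ≠ a → i.val ≠ a + 1 → u i = u' i) →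
        y g u = y g u')
    (v : Fin (a + q) → Bool) (hE : (2 * wt v) % 3 = E c y w v) :
    ∃ t : Fin 3, ringWinU c y (emb t v) = false := by
  by_contra hall
  have hwin : ∀ t : Fin 3, (univ.filter fun g : Fin (a + 2 + q + 1) =>
      y g (emb t v) = true ∧ (c + g.val + walkExp (emb t v) g.val) % 3 ≠ 0).card % 2 = 1 := by
    intro t
    have h : ringWinU c y (emb t v) = true := by
      cases hb : ringWinU c y (emb t v)
      · exact absurd ⟨t, hb⟩ hall
      · rfl
    exact (ringWinU_emb_iff c y t v).1 h
  have hodd : (∑ t : Fin 3, (univ.filter fun g : Fin (a + 2 + q + 1) =>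
      y g (emb t v) = true ∧ (c + g.val + walkExp (emb t v) g.val) % 3 ≠ 0).card) % 2 = 1 := by
    rw [Fin.sum_univ_three]
    have := hwin 0; have := hwin 1; have := hwin 2; omega
  rw [sum_card_speeds, ← Finset.sum_filter_add_sum_filter_not univ
    (fun g : Fin (a + 2 + q + 1) => a ≤ g.val + w ∧ g.val ≤ a + 2 + w)] at hodd
  have hfar0 : (∑ g ∈ univ.filter (fun g : Fin (a + 2 + q + 1) => ¬ (a ≤ g.val + w ∧ g.val ≤ a + 2 + w)),
      (T c y g v).card) % 2 = 0 := by
    rw [Finset.sum_nat_mod, Finset.sum_eq_zero, Nat.zero_mod]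
    intro g hg
    have hg' := (mem_filter.1 hg).2
    exact card_T_even c y (by omega) (hfar g (by omega)) v
  have hnear : (∑ g ∈ near w, (T c y g v).card) % 2 = 0 := by
    rw [sum_near_T, hE]; exact M_E_even c y w v
  unfold near at hnear
  omega

/-! ### The named phase is determined by the near outputs and the local rest bits -/

/-- `Ω_g(t, ·) mod 3` depends only on the `≤ 2w` rest bits next to the pair (for a near cut `g`). -/
theorem Om_mod_congr {w : ℕ} {g : Fin (a + 2 + q + 1)} (hg : a ≤ g.val + w ∧ g.val ≤ a + 2 + w) (t : Fin 3)
    {v v' : Fin (a + q) → Bool} (hloc : ∀ i : Fin (a + q), a ≤ i.val + w → i.val < a + w → v i = v' i) :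
    Om c g t v % 3 = Om c g t v' % 3 := by
  unfold Om walkExp
  have hw := wt_emb t v
  have hw' := wt_emb t v'
  have hr := wt_rest v
  have hr' := wt_rest v'
  by_cases h1 : g.val ≤ a
  · rw [wtPrefix_emb_of_le t v h1, wtPrefix_emb_of_le t v' h1]
    have hs := wtPrefix_eq_add g.val (vL v) h1
    have hs' := wtPrefix_eq_add g.val (vL v') h1
    rw [wtPrefix_of_length_le _ le_rfl] at hs hs'
    have hwin : winCnt g.val (vL v) a = winCnt g.val (vL v') a := by
      unfold winCnt
      refine congrArg _ (Finset.filter_congr fun j _ => ?_)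
      by_cases hja : g.val ≤ j.val
      · have e : vL v j = vL v' j := hloc (Fin.castAdd q j) (by simp; omega) (by simp; omega)
        rw [e]
      · simp [hja]
    omega
  · by_cases h2 : g.val = a + 1
    · rw [h2, wtPrefix_emb_succ, wtPrefix_emb_succ]
      omega
    · have h3 : a + 2 ≤ g.val := by omega
      have hp := wtPrefix_emb_of_ge t v h3 (by omega)
      have hp' := wtPrefix_emb_of_ge t v' h3 (by omega)
      have hR : wtPrefix (vR v) (g.val - (a + 2)) = wtPrefix (vR v') (g.val - (a + 2)) := by
        unfold wtPrefix
        refine congrArg _ (Finset.filter_congr fun j _ => ?_)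
        by_cases hj : j.val < g.val - (a + 2)
        · have e : vR v j = vR v' j := hloc (Fin.natAdd a j) (by simp; omega) (by simp; omega)
          rw [e]
        · simp [hj]
      omega

end PairSpeed

end Summit.QuantumAdvantage.AdviceFreeQNC0

end
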